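import Summits.Schanuel.Schanuel.Theorems.RootDecomp1KLevelFinite04

/-!
# RootDecomp1KLevelFinite — lens 1, generation 51 ADDENDUM «BOTH SPLIT CONJUGATE-POLES LEAVES CLOSED: normShapeLF_holds» (§8 SplitGrades) — continuation (RootDecomp1KLevelFinite05): §8.0 norms in PadicAlgCl 2, binary forms + §8.1 Bezout identities

(lens-1 g51 ADDENDUM kernel K″ = HOME/decomp-schanuel-lens-1/g51/LevelFiniteSplit.lean 375ea065…, 2255 l = node-10 K b1fbaeff… VERBATIM (843/843 lines in order; ported as RootDecomp1KLevelFinite01–04) + TWO pure insertions: an addendum module docstring and `§8 section SplitGrades` (K″ l.863–2252, 75 decls); same single import …RootDecomp1KXLinear05; P″ LevelFiniteSplitProbe.lean rc 0 / C₀″ rc 0 / C″ LevelFiniteSplitCtrl.lean rc 1 = 10 planted; ADDENDUM/NODE L2486 / REQUEST L2487, critic VERDICT L2488: CLEARED under RULE K-R40 (ii)/(v) — ONE THEOREM ×1 «CONJUGATE-POLES LEAVES CLOSED: (NormShapeLevels g q a D).Finite for EVERY NormShapeHyp g q a D, uniformly over all grades, by a two-pass 2-adic Ridout argument in PadicAlgCl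 2 on the tree's `RootDecomp1KXLinearCore.ridout_step`»; writer re-check L2489; PORT GO. Port by census-1 gen 21 of §8 as `RootDecomp1KLevelFinite05–09` continuing the 01–04 chain: 05 = §8.0 norms of integers in `PadicAlgCl 2`, binary forms `hform`, + §8.1 Bezout identities (`cpoly`, `bezout_forms`); 06 = §8.2 resultant data of a conjugate-poles shape + §8.3 the monicised quadratic in 𝕂 (`two_roots`, `ghatc`); 07 = §8.4 one level: integer bookkeeping (`psNumer_le`, `hform_two_eq`, …) + §8.5 the 𝕂-side (`nearest_root`, root extraction, `lamq`); 08 = §8.6 one level: height, arithmetic and the 2-adic closeness (`heightC`, `level_arith`, `level_padic`); 09 = §8.7 assembly **`normShapeLF_holds`** + §8.8 corollaries `normShapeLFSplitImag_holds` / `normShapeLFSplitReal_holds` (the two K binders LITERALLY), `levelFinite_of_siegelShapes''` / `thinFibre_of_siegelShapes''` / `b_of_siegelShapes''` (⟸ `SiegelShapes` ALONE) + §8.9 hyp-free instances `normShapeCurve`, `levelFinite_normShapeCurve`, `levelFinite_sqrt17_curve` (g47's residual (δ) family member DECIDED). PORT EDITS (census convention, pre-sanctioned L2488): `psNumer_pos'`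 privatised (homonym statement of private tree `psNumer_pos`); `isCoprime_num_den` stays private (privatised in 03; private copies where §8 calls it); 24 one-line helper docstrings (statements quoted); `section SplitGrades` with its two `open … (…)` lines closed / re-opened per part, the `open … (bev_map_C)` of §8.9 travels inside 09; statements and proofs otherwise verbatim, no renames, no heartbeat lines. `--supports stmt-Schanuel-33364`; no census credit carried; rung 0 — nothing here proves Schanuel, 33364, 31077, 33363, SiegelShapes, or ThinFibre m₀ / (b) hypothesis-free.)
-/

noncomputable section

open Polynomial LiouvilleNumber
open scoped Nat

namespace Summit.Schanuel.Schanuel.Theorems.RootDecomp1KLevelFinite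

open Summit.Schanuel.Schanuel.Theorems.RootDecomp1KSkelCell (iota SkelLiouville SkelLiouvilleFix
  skelLiouville_iff_fix SkelLiouvilleFix.mono)
open Summit.Schanuel.Schanuel.Theorems.RootDecomp1KTwoBaseCell (psNumer partialSum_eq_psNumer_div coprime_psNumer
  sb_of_range_eq')
open Summit.Schanuel.Schanuel.Theorems.RootDecomp1KRelLiouvilleCell (partialSum_two_strictMono)
open Summit.Schanuel.Schanuel.Theorems.RootDecomp1KDegreeLadder
open Summit.Schanuel.Schanuel.Theorems.RootDecomp1KXLinear (xLinP bev_xLinP aeval_ratCast levels_finite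
  thinFibreAt_mul_left)
open Summit.Schanuel.Schanuel.Theorems.RootDecomp1KHyper (SB SFset sb_of_algebraicIndependent)

/-! ## §8 (ADDENDUM) EVERY conjugate-poles grade — PROVED from the tree's `2`-adic Ridout step `ridout_step`
(itself from `Literature…Ridout.padicRoth_int`); supersedes the split/non-split trichotomy of §2 (§7 stays as the
elementary proof of the non-split grade).

Uniform treatment of ALL conjugate-pole shapes in `𝕂 = PadicAlgCl 2` (no case split on the splitting of `2`, no Hensel,
no number field).  With `t = u/v` in lowest terms, `Q = Q(u,v) = v²q(t)`, `G = G(u,v) = v^{2a}g(t)`, `H = max(|u|,|v|)`: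
(§8.1–8.2) Bezout/resultant identities `A·G + B·Q = d₁v^K` (and the reflected chart) with height-controlled `A, B`, and
`m ∣ G, m ∣ Q, (u,v) = 1 ⟹ m ∣ d`; (§8.4, §8.6) the level equation `2^{N!}G = D·p_N·Q^a` (`p_N` odd, `≡ 1 mod
2^{N!−(N−1)!}`) gives `Q = m·2^w` with `|m| ≤ |d|`, `G = p_N·κ` with `|κ| ≤ |D||d|^a 2^{E₀}`, `a·w ≤ N! + E₀`, and the
HEIGHT BOUND `H² ≤ C_h·|Q| ≤ C_h|d|·2^w`; (§8.3) in `𝕂` the monicised quadratic has roots `θ₁ ≠ θ₂` of norm `≤ 1`,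
`q₂·Q = (q₂u − θ₁v)(q₂u − θ₂v)`, so `‖q₂u − θv‖ ≤ 2^{−w}/δ` for one root `θ`; (§8.6 `level_padic`) the Lipschitz bound
for forms gives `‖v^{2a}ĝ(θ) − q₂^{2a}κ‖ ≤ 2^{−w}/δ + 2^{−(N!−(N−1)!)}`, i.e. `v^{2a}` is `2`-adically close to one of
finitely many algebraic targets `λ(κ,θ)`; (§8.5) root extraction `‖v − ζ‖ ≤ C₁·η` for `ζ` in a finite algebraic set;
(§8.7) with `t' = ⌈w/2⌉`, `|v| ≤ A₀2^{t'}` and closeness `≲ (2^{−t'})^{3/2}`: `ridout_step` (ρ = 3/2, L = 1) leaves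
finitely many `v`, then `ridout_step` (L = v, ζ ∈ {θ₁, θ₂}) finitely many `q₂u`, hence finitely many `t`, finitely
many levels (`sQ` injective). -/

section SplitGrades

open Summit.Schanuel.Schanuel.Theorems.RootDecomp1KXLinearCore (roots_structure ridout_step)
open Summit.Schanuel.Schanuel.Theorems.RootDecomp1KXLinear (norm_psNumer_sub_one)

/-! ### §8.0 norms of integers in `PadicAlgCl 2`; binary forms -/

/-- `(z : ℤ) : ‖(z : PadicAlgCl 2)‖ ≤ 1`. -/
theorem normK_intCast_le_one (z : ℤ) : ‖(z : PadicAlgCl 2)‖ ≤ 1 := by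
  have h1 : (z : PadicAlgCl 2) = algebraMap ℚ_[2] (PadicAlgCl 2) (z : ℚ_[2]) := (map_intCast _ z).symm
  rw [h1, PadicAlgCl.norm_extends]
  have h2 : ((z : ℤ_[2]) : ℚ_[2]) = (z : ℚ_[2]) := by simp
  rw [← h2]
  exact PadicInt.norm_le_one _

/-- `{z : ℤ} {n : ℕ} (h : (2 : ℤ) ^ n ∣ z) : ‖(z : PadicAlgCl 2)‖ ≤ (1 / 2 : ℝ) ^ n`. -/
theorem normK_intCast_le_of_dvd {z : ℤ} {n : ℕ} (h : (2 : ℤ) ^ n ∣ z) :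
    ‖(z : PadicAlgCl 2)‖ ≤ (1 / 2 : ℝ) ^ n := by
  have h1 : (z : PadicAlgCl 2) = algebraMap ℚ_[2] (PadicAlgCl 2) (z : ℚ_[2]) := (map_intCast _ z).symm
  rw [h1, PadicAlgCl.norm_extends]
  have h2 : ‖(z : ℚ_[2])‖ ≤ ((2 : ℕ) : ℝ) ^ (-n : ℤ) := (Padic.norm_int_le_pow_iff_dvd z n).mpr (by exact_mod_cast h)
  have h3 : ((2 : ℕ) : ℝ) ^ (-n : ℤ) = (1 / 2 : ℝ) ^ n := by
    rw [zpow_neg, zpow_natCast, one_div, inv_pow]; norm_num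
  rwa [h3] at h2

/-- `{z : ℤ} {n : ℕ} (h : ¬ (2 : ℤ) ^ n ∣ z) : (1 / 2 : ℝ) ^ n < ‖(z : PadicAlgCl 2)‖`. -/
theorem normK_intCast_gt_of_not_dvd {z : ℤ} {n : ℕ} (h : ¬ (2 : ℤ) ^ n ∣ z) :
    (1 / 2 : ℝ) ^ n < ‖(z : PadicAlgCl 2)‖ := by
  have h1 : (z : PadicAlgCl 2) = algebraMap ℚ_[2] (PadicAlgCl 2) (z : ℚ_[2]) := (map_intCast _ z).symm
  rw [h1, PadicAlgCl.norm_extends]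
  have h2 : ¬ ‖(z : ℚ_[2])‖ ≤ ((2 : ℕ) : ℝ) ^ (-n : ℤ) := fun h' =>
    h (by exact_mod_cast (Padic.norm_int_le_pow_iff_dvd z n).mp h')
  have h3 : ((2 : ℕ) : ℝ) ^ (-n : ℤ) = (1 / 2 : ℝ) ^ n := by
    rw [zpow_neg, zpow_natCast, one_div, inv_pow]; norm_num
  rw [h3] at h2
  exact lt_of_not_ge h2

/-- `(x y : PadicAlgCl 2) : ‖x - y‖ ≤ max ‖x‖ ‖y‖`. -/
theorem normK_sub_le_max (x y : PadicAlgCl 2) : ‖x - y‖ ≤ max ‖x‖ ‖y‖ := by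
  have := IsUltrametricDist.norm_add_le_max x (-y)
  rwa [norm_neg, ← sub_eq_add_neg] at this

/-- `‖x^j − y^j‖ ≤ ‖x − y‖` in the closed unit ball of an ultrametric field. -/
theorem normK_pow_sub_pow_le (x y : PadicAlgCl 2) (hx : ‖x‖ ≤ 1) (hy : ‖y‖ ≤ 1) (j : ℕ) :
    ‖x ^ j - y ^ j‖ ≤ ‖x - y‖ := by
  induction j with
  | zero => simp
  | succ j ih =>
    have hsplit : x ^ (j + 1) - y ^ (j + 1) = x * (x ^ j - y ^ j) + (x - y) * y ^ j := by ring
    rw [hsplit]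
    refine (IsUltrametricDist.norm_add_le_max _ _).trans (max_le ?_ ?_)
    · rw [norm_mul]
      calc ‖x‖ * ‖x ^ j - y ^ j‖ ≤ 1 * ‖x - y‖ := by gcongr
        _ = ‖x - y‖ := one_mul _
    · rw [norm_mul, norm_pow]
      calc ‖x - y‖ * ‖y‖ ^ j ≤ ‖x - y‖ * 1 ^ j := by gcongr
        _ = ‖x - y‖ := by rw [one_pow, mul_one]

/-- [auxiliary] the BINARY FORM of degree `n` with coefficient function `c`: `Σ_{i ≤ n} cᵢ uⁱ v^{n−i}`. -/
def hform {R : Type*} [CommRing R] (c : ℕ → ℤ) (n : ℕ) (u v : R) : R :=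
  ∑ i ∈ Finset.range (n + 1), (c i : R) * u ^ i * v ^ (n - i)

/-- `{R : Type*} [CommRing R] (c : ℕ → ℤ) (n : ℕ) (u v : ℤ) : ((hform c n u v : ℤ) : R) = hform c n (u : R) (v : R)`. -/
theorem hform_intCast {R : Type*} [CommRing R] (c : ℕ → ℤ) (n : ℕ) (u v : ℤ) :
    ((hform c n u v : ℤ) : R) = hform c n (u : R) (v : R) := by
  simp [hform, Int.cast_sum, Int.cast_mul, Int.cast_pow]

/-- over a field, `hform c n u v = vⁿ · Σ cᵢ (u/v)ⁱ`. -/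
theorem hform_eq_pow_mul_sum {F : Type*} [Field F] (c : ℕ → ℤ) (n : ℕ) (u v : F) (hv : v ≠ 0) :
    hform c n u v = v ^ n * ∑ i ∈ Finset.range (n + 1), (c i : F) * (u / v) ^ i := by
  unfold hform
  rw [Finset.mul_sum]
  refine Finset.sum_congr rfl fun i hi => ?_
  have hi' : i ≤ n := Nat.lt_succ_iff.mp (Finset.mem_range.mp hi)
  rw [div_pow, show v ^ n = v ^ i * v ^ (n - i) by rw [← pow_add, Nat.add_sub_cancel' hi']]
  field_simp

/-- `Σ_{i ≤ n} (p.coeff i) xⁱ = aeval x p` when `natDegree p ≤ n`. -/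
theorem sum_coeff_eq_aeval {S : Type*} [CommRing S] [Algebra ℤ S] (p : ℤ[X]) {n : ℕ} (hn : p.natDegree ≤ n)
    (x : S) : ∑ i ∈ Finset.range (n + 1), (p.coeff i : S) * x ^ i = aeval x p := by
  rw [aeval_eq_sum_range' (Nat.lt_succ_of_le hn)]
  refine Finset.sum_congr rfl fun i _ => ?_
  rw [Algebra.smul_def, eq_intCast]

/-- `hform p.coeff n (t.num) (t.den) = t.denⁿ · p(t)` in `ℚ`. -/
theorem hform_num_den (p : ℤ[X]) {n : ℕ} (hn : p.natDegree ≤ n) (t : ℚ) :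
    ((hform p.coeff n t.num (t.den : ℤ) : ℤ) : ℚ) = (t.den : ℚ) ^ n * aeval t p := by
  rw [hform_intCast, Int.cast_natCast, hform_eq_pow_mul_sum _ _ _ _ (by exact_mod_cast t.den_nz),
    Rat.num_div_den t, ← sum_coeff_eq_aeval p hn t]

/-- homogeneity: `hform c n (θ v) v = vⁿ · hform c n θ 1`. -/
theorem hform_mul_left {R : Type*} [CommRing R] (c : ℕ → ℤ) (n : ℕ) (θ v : R) :
    hform c n (θ * v) v = v ^ n * hform c n θ 1 := by
  unfold hform
  rw [Finset.mul_sum]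
  refine Finset.sum_congr rfl fun i hi => ?_
  have hi' : i ≤ n := Nat.lt_succ_iff.mp (Finset.mem_range.mp hi)
  rw [one_pow, mul_one, mul_pow, show v ^ n = v ^ i * v ^ (n - i) by rw [← pow_add, Nat.add_sub_cancel' hi']]
  ring

/-- scaling: `q₂ⁿ · hform c n u v = hform (i ↦ cᵢ q₂^{n−i}) n (q₂u) v`. -/
theorem hform_scale {R : Type*} [CommRing R] (c : ℕ → ℤ) (n : ℕ) (q₂ : ℤ) (u v : R) :
    (q₂ : R) ^ n * hform c n u v = hform (fun i => c i * q₂ ^ (n - i)) n ((q₂ : R) * u) v := by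
  unfold hform
  rw [Finset.mul_sum]
  refine Finset.sum_congr rfl fun i hi => ?_
  have hi' : i ≤ n := Nat.lt_succ_iff.mp (Finset.mem_range.mp hi)
  rw [Int.cast_mul, Int.cast_pow, mul_pow,
    show (q₂ : R) ^ n = (q₂ : R) ^ i * (q₂ : R) ^ (n - i) by rw [← pow_add, Nat.add_sub_cancel' hi']]
  ring

/-- reflection: `hform c n u v = hform (i ↦ c (n − i)) n v u`. -/
theorem hform_reflect {R : Type*} [CommRing R] (c : ℕ → ℤ) (n : ℕ) (u v : R) :
    hform c n u v = hform (fun i => c (n - i)) n v u := by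
  unfold hform
  rw [← Finset.sum_range_reflect]
  refine Finset.sum_congr rfl fun i hi => ?_
  have hi' : i < n + 1 := Finset.mem_range.mp hi
  have h1 : n + 1 - 1 - i = n - i := by omega
  have h2 : n - (n - i) = i := by omega
  rw [h1, h2]
  ring

/-- LIPSCHITZ bound in the unit ball of `𝕂`: `‖hform c n x v − hform c n y v‖ ≤ ‖x − y‖`. -/
theorem hform_lipschitz (c : ℕ → ℤ) (n : ℕ) (x y v : PadicAlgCl 2) (hx : ‖x‖ ≤ 1) (hy : ‖y‖ ≤ 1)
    (hv : ‖v‖ ≤ 1) : ‖hform c n x v - hform c n y v‖ ≤ ‖x - y‖ := by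
  unfold hform
  rw [← Finset.sum_sub_distrib]
  refine IsUltrametricDist.norm_sum_le_of_forall_le_of_nonneg (norm_nonneg _) fun i _ => ?_
  rw [show (c i : PadicAlgCl 2) * x ^ i * v ^ (n - i) - (c i : PadicAlgCl 2) * y ^ i * v ^ (n - i)
      = (c i : PadicAlgCl 2) * v ^ (n - i) * (x ^ i - y ^ i) by ring, norm_mul, norm_mul, norm_pow]
  calc ‖(c i : PadicAlgCl 2)‖ * ‖v‖ ^ (n - i) * ‖x ^ i - y ^ i‖ ≤ 1 * 1 ^ (n - i) * ‖x - y‖ := by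
        gcongr
        · exact normK_intCast_le_one _
        · exact normK_pow_sub_pow_le x y hx hy i
    _ = ‖x - y‖ := by rw [one_pow, one_mul, one_mul]

/-- `(c : ℕ → ℤ) (n : ℕ) (u v : ℤ) : |((hform c n u v : ℤ) : ℝ)| ≤ (∑ i ∈ Finset.range (n + 1), |(c i : ℝ)|) * (max |(u : ℝ)| |(v : ℝ)|) ^ n`. -/
theorem abs_hform_le (c : ℕ → ℤ) (n : ℕ) (u v : ℤ) :
    |((hform c n u v : ℤ) : ℝ)| ≤ (∑ i ∈ Finset.range (n + 1), |(c i : ℝ)|) * (max |(u : ℝ)| |(v : ℝ)|) ^ n := by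
  rw [hform_intCast, hform, Finset.sum_mul]
  refine (Finset.abs_sum_le_sum_abs _ _).trans (Finset.sum_le_sum fun i hi => ?_)
  have hi' : i ≤ n := Nat.lt_succ_iff.mp (Finset.mem_range.mp hi)
  rw [abs_mul, abs_mul, abs_pow, abs_pow]
  calc |((c i : ℤ) : ℝ)| * |(u : ℝ)| ^ i * |(v : ℝ)| ^ (n - i)
      ≤ |((c i : ℤ) : ℝ)| * (max |(u : ℝ)| |(v : ℝ)|) ^ i * (max |(u : ℝ)| |(v : ℝ)|) ^ (n - i) := by
        gcongr
        · exact le_max_left _ _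
        · exact le_max_right _ _
    _ = |((c i : ℤ) : ℝ)| * (max |(u : ℝ)| |(v : ℝ)|) ^ n := by
        rw [mul_assoc, ← pow_add, Nat.add_sub_cancel' hi']

/-! ### §8.1 Bezout identities for binary forms (resultant bookkeeping) -/

/-- [auxiliary] the rational polynomial `Σ_{i ≤ n} cᵢ Xⁱ`. -/
noncomputable def cpoly (c : ℕ → ℤ) (n : ℕ) : ℚ[X] :=
  ∑ i ∈ Finset.range (n + 1), C (c i : ℚ) * X ^ i

/-- `{F : Type*} [Field F] [Algebra ℚ F] (c : ℕ → ℤ) (n : ℕ) (x : F) : aeval x (cpoly c n) = ∑ i ∈ Finset.range (n + 1), (c i : F) * x ^ i`. -/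
theorem aeval_cpoly {F : Type*} [Field F] [Algebra ℚ F] (c : ℕ → ℤ) (n : ℕ) (x : F) :
    aeval x (cpoly c n) = ∑ i ∈ Finset.range (n + 1), (c i : F) * x ^ i := by
  simp [cpoly, map_sum]

/-- `(p : ℤ[X]) {n : ℕ} (hn : p.natDegree ≤ n) : cpoly p.coeff n = p.map (Int.castRingHom ℚ)`. -/
theorem cpoly_coeff_eq_map (p : ℤ[X]) {n : ℕ} (hn : p.natDegree ≤ n) :
    cpoly p.coeff n = p.map (Int.castRingHom ℚ) := by
  have h1 : (p.map (Int.castRingHom ℚ)).natDegree < n + 1 :=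
    lt_of_le_of_lt ((natDegree_map_le).trans hn) (Nat.lt_succ_self n)
  rw [as_sum_range' _ _ h1, cpoly]
  refine Finset.sum_congr rfl fun i _ => ?_
  rw [coeff_map, eq_intCast, C_mul_X_pow_eq_monomial]

/-- `{F : Type*} [Field F] [Algebra ℚ F] (p : ℤ[X]) {n : ℕ} (hn : p.natDegree ≤ n) (x : F) : aeval x (cpoly p.coeff n) = aeval x p`. -/
theorem aeval_cpoly_coeff {F : Type*} [Field F] [Algebra ℚ F] (p : ℤ[X]) {n : ℕ} (hn : p.natDegree ≤ n)
    (x : F) : aeval x (cpoly p.coeff n) = aeval x p := by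
  rw [cpoly_coeff_eq_map p hn, ← algebraMap_int_eq, aeval_map_algebraMap]

/-- clearing denominators of a rational polynomial, coefficientwise. -/
theorem exists_clear_denom (A : ℚ[X]) :
    ∃ (d : ℤ) (z : ℕ → ℤ), d ≠ 0 ∧ ∀ i, (z i : ℚ) = d * A.coeff i := by
  classical
  set d : ℤ := ∏ j ∈ Finset.range (A.natDegree + 1), ((A.coeff j).den : ℤ) with hd
  have hd0 : d ≠ 0 := Finset.prod_ne_zero_iff.mpr fun j _ => by exact_mod_cast (A.coeff j).den_nz
  refine ⟨d, fun i => (A.coeff i).num * (d / (A.coeff i).den), hd0, fun i => ?_⟩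
  by_cases hi : i ≤ A.natDegree
  · have hdvd : ((A.coeff i).den : ℤ) ∣ d :=
      Finset.dvd_prod_of_mem _ (Finset.mem_range.mpr (Nat.lt_succ_of_le hi))
    obtain ⟨k, hk⟩ := hdvd
    have hden : ((A.coeff i).den : ℤ) ≠ 0 := by exact_mod_cast (A.coeff i).den_nz
    dsimp only
    rw [hk, Int.mul_ediv_cancel_left _ hden]
    push_cast
    rw [show ((A.coeff i).den : ℚ) * k * A.coeff i = k * (A.coeff i * (A.coeff i).den) by ring,
      Rat.mul_den_eq_num]
    ring
  · have h0 : A.coeff i = 0 := coeff_eq_zero_of_natDegree_lt (not_le.mp hi)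
    simp [h0]

/-- **Bezout for binary forms (`v`-chart).**  If the truncated polynomials `P₁ = Σ c₁ᵢXⁱ`, `P₂ = Σ c₂ᵢXⁱ` are coprime
in `ℚ[X]`, there are `d ≠ 0`, `K` and `C` with: for all integers `u, v`, `v ≠ 0`, some integers `A, B` satisfy
`A·hform c₁ n₁ u v + B·hform c₂ n₂ u v = d·v^K`, `|A| ≤ C·H^{K−n₁}`, `|B| ≤ C·H^{K−n₂}` (`H = max(|u|,|v|)`). -/
theorem bezout_forms (c₁ c₂ : ℕ → ℤ) (n₁ n₂ : ℕ) (hbez : IsCoprime (cpoly c₁ n₁) (cpoly c₂ n₂)) :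
    ∃ (d : ℤ) (K : ℕ) (Cb : ℝ), d ≠ 0 ∧ n₁ ≤ K ∧ n₂ ≤ K ∧ 0 < Cb ∧
      ∀ u v : ℤ, v ≠ 0 → ∃ A B : ℤ,
        A * hform c₁ n₁ u v + B * hform c₂ n₂ u v = d * v ^ K ∧
        |(A : ℝ)| ≤ Cb * (max |(u : ℝ)| |(v : ℝ)|) ^ (K - n₁) ∧
        |(B : ℝ)| ≤ Cb * (max |(u : ℝ)| |(v : ℝ)|) ^ (K - n₂) := by
  obtain ⟨a, b, hab⟩ := hbez
  obtain ⟨da, za, hda, hza⟩ := exists_clear_denom a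
  obtain ⟨db, zb, hdb, hzb⟩ := exists_clear_denom b
  set α := a.natDegree with hα
  set β := b.natDegree with hβ
  set K := max (α + n₁) (β + n₂) with hK
  set Sa : ℝ := ∑ i ∈ Finset.range (α + 1), |(za i : ℝ)| with hSa
  set Sb : ℝ := ∑ i ∈ Finset.range (β + 1), |(zb i : ℝ)| with hSb
  have hSa0 : 0 ≤ Sa := Finset.sum_nonneg fun i _ => abs_nonneg _
  have hSb0 : 0 ≤ Sb := Finset.sum_nonneg fun i _ => abs_nonneg _
  refine ⟨da * db, K, |(db : ℝ)| * Sa + |(da : ℝ)| * Sb + 1, mul_ne_zero hda hdb,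
    le_trans (Nat.le_add_left _ _) (le_max_left _ _), le_trans (Nat.le_add_left _ _) (le_max_right _ _),
    by positivity, ?_⟩
  intro u v hv
  set e₁ := K - n₁ - α with he₁
  set e₂ := K - n₂ - β with he₂
  have hK1 : K = e₁ + α + n₁ := by omega
  have hK2 : K = e₂ + β + n₂ := by omega
  refine ⟨db * v ^ e₁ * hform za α u v, da * v ^ e₂ * hform zb β u v, ?_, ?_, ?_⟩
  · -- the identity, checked in `ℚ` at `t = u/v`
    have hvQ : (v : ℚ) ≠ 0 := by exact_mod_cast hv
    set t : ℚ := (u : ℚ) / (v : ℚ) with ht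
    have hsa : ∑ i ∈ Finset.range (α + 1), (za i : ℚ) * t ^ i = da * aeval t a := by
      rw [aeval_eq_sum_range, Finset.mul_sum]
      refine Finset.sum_congr rfl fun i _ => ?_
      rw [hza i, smul_eq_mul]; ring
    have hsb : ∑ i ∈ Finset.range (β + 1), (zb i : ℚ) * t ^ i = db * aeval t b := by
      rw [aeval_eq_sum_range, Finset.mul_sum]
      refine Finset.sum_congr rfl fun i _ => ?_
      rw [hzb i, smul_eq_mul]; ring
    have hev := congrArg (aeval t) hab
    simp only [map_add, map_mul, map_one] at hev
    apply Int.cast_injective (α := ℚ)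
    push_cast
    rw [hform_intCast, hform_intCast, hform_intCast, hform_intCast,
      hform_eq_pow_mul_sum za α _ _ hvQ, hform_eq_pow_mul_sum zb β _ _ hvQ,
      hform_eq_pow_mul_sum c₁ n₁ _ _ hvQ, hform_eq_pow_mul_sum c₂ n₂ _ _ hvQ, ← ht, hsa, hsb,
      ← aeval_cpoly c₁ n₁ t, ← aeval_cpoly c₂ n₂ t]
    have h1 : (db : ℚ) * (v : ℚ) ^ e₁ * ((v : ℚ) ^ α * (da * aeval t a)) * ((v : ℚ) ^ n₁ * aeval t (cpoly c₁ n₁))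
        = da * db * (v : ℚ) ^ K * (aeval t a * aeval t (cpoly c₁ n₁)) := by
      rw [hK1]; ring
    have h2 : (da : ℚ) * (v : ℚ) ^ e₂ * ((v : ℚ) ^ β * (db * aeval t b)) * ((v : ℚ) ^ n₂ * aeval t (cpoly c₂ n₂))
        = da * db * (v : ℚ) ^ K * (aeval t b * aeval t (cpoly c₂ n₂)) := by
      rw [hK2]; ring
    rw [h1, h2]
    linear_combination ((da : ℚ) * db * (v : ℚ) ^ K) * hev
  · have hH : |(v : ℝ)| ≤ max |(u : ℝ)| |(v : ℝ)| := le_max_right _ _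
    have hA := abs_hform_le za α u v
    push_cast
    rw [abs_mul, abs_mul, abs_pow]
    calc |(db : ℝ)| * |(v : ℝ)| ^ e₁ * |((hform za α u v : ℤ) : ℝ)|
        ≤ |(db : ℝ)| * (max |(u : ℝ)| |(v : ℝ)|) ^ e₁ * (Sa * (max |(u : ℝ)| |(v : ℝ)|) ^ α) := by
          rw [hform_intCast] at hA ⊢; gcongr
      _ = (|(db : ℝ)| * Sa) * (max |(u : ℝ)| |(v : ℝ)|) ^ (K - n₁) := by
          rw [show K - n₁ = e₁ + α by omega, pow_add]; ring
      _ ≤ (|(db : ℝ)| * Sa + |(da : ℝ)| * Sb + 1) * (max |(u : ℝ)| |(v : ℝ)|) ^ (K - n₁) := by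
          gcongr; nlinarith [abs_nonneg (da : ℝ)]
  · have hH : |(v : ℝ)| ≤ max |(u : ℝ)| |(v : ℝ)| := le_max_right _ _
    have hB := abs_hform_le zb β u v
    push_cast
    rw [abs_mul, abs_mul, abs_pow]
    calc |(da : ℝ)| * |(v : ℝ)| ^ e₂ * |((hform zb β u v : ℤ) : ℝ)|
        ≤ |(da : ℝ)| * (max |(u : ℝ)| |(v : ℝ)|) ^ e₂ * (Sb * (max |(u : ℝ)| |(v : ℝ)|) ^ β) := by
          rw [hform_intCast] at hB ⊢; gcongr
      _ = (|(da : ℝ)| * Sb) * (max |(u : ℝ)| |(v : ℝ)|) ^ (K - n₂) := by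
          rw [show K - n₂ = e₂ + β by omega, pow_add]; ring
      _ ≤ (|(db : ℝ)| * Sa + |(da : ℝ)| * Sb + 1) * (max |(u : ℝ)| |(v : ℝ)|) ^ (K - n₂) := by
          gcongr; nlinarith [abs_nonneg (db : ℝ)]

end SplitGrades

end Summit.Schanuel.Schanuel.Theorems.RootDecomp1KLevelFinite

end
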